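import Mathlib
import Literature.Analysis.FluidPDE.PressureReconstruction
import Literature.Analysis.FluidPDE.WeakGradientIBP
import Literature.Analysis.FluidPDE.SteadyEulerVelocityTesting
import Summits.NavierStokesRegularity.NavierStokesRegularity.Theorems.EulerZoomLiouvillePowerGaugeEulerLiouvilleIrrotationalTools
import Summits.NavierStokesRegularity.NavierStokesRegularity.Theorems.EulerZoomLiouvillePowerGaugeEulerLiouvilleWeakHomogeneityKill
import HarnessLib

/-!
# Crux `EulerZoomLiouville.PowerGaugeEulerLiouville` (stmt-NavierStokesRegularity-19832), stub `stub_selfSimilarWeakRest`: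
# IN THE WEAK CLASS, A CURL-TESTED PROFILE IDENTITY WITHOUT LAMB TERM FORCES A SYMMETRIC WEAK GRADIENT (weak «commuting ⇒ irrotational»)

Helper file (theorems only; `--supports stmt-NavierStokesRegularity-19832`; def-free).  Hand leafhand-ns-eulerzoomliouville-10 g1, weak-class
sequel of `…SelfSimilarCommutingVorticity` (classical: commuting velocity/vorticity ⇒ irrotational) using the distributional Euler-homogeneity
kill `…WeakHomogeneityKill`.

Setting (profile level, no regularity beyond the weak class): `V : ℝ³ → ℝ³` with a whole-space weak gradient `G` (`HasWeakGradient V G`),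
and the CURL-TESTED WEAK PROFILE IDENTITY WITHOUT LAMB TERM at rate `γ`:

  `γ (∫ ⟪V, Dη_ψ(y)[y]⟫) + (4γ − 1) (∫ ⟪V, η_ψ⟫) = 0`  for every test function `ψ` and vectors `v, w`,  `η_ψ := (∂ᵥψ) w − (∂_w ψ) v`

— this is the tree's distributional profile equation `ProfileEquation.weak_profile_equation` (`∫⟪V,(V·∇)η⟫ + P div η + γ⟪V,(y·∇)η⟫ +
(4γ−1)⟪V,η⟫ = 0`) tested with the divergence-free curl-type fields `η_ψ` (`P div η_ψ = 0`), in which the velocity-tested weak curl of the Lamb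
vector `∫⟪V, (V·∇)η_ψ⟫` VANISHES (the weak form of `curl (curl V × V) = 0`, i.e. of «velocity and vorticity commute»).  Then:

* `WeakCommuting.fderiv_curlPair_apply_self` — pointwise calculus: `Dη_ψ(y)[y] = η_h(y) − η_ψ(y)` with `h = Dψ[y]` the radial derivative;
* `WeakCommuting.weakCurl_euler_identity` — the scalar weak curls `ω_{v,w} = ⟪G v, w⟫ − ⟪G w, v⟫ ∈ L¹_loc` satisfy the EULER IDENTITY IN `𝒟'`
  of degree `κ = −1/γ`: `∫ Dφ[y] ω = −(3+κ)∫ φ ω`;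
* `WeakCommuting.weakCurl_ae_eq_zero` — if `‖G‖²` is integrable on the closed unit ball and `0 < γ < 2/3` (every class rate `1/(2+ρ)`), then
  `ω_{v,w} = 0` a.e. for all `v, w` (`WeakHomogeneity.ae_eq_zero_of_sq_integrableOn`): THE WEAK GRADIENT IS A.E. SYMMETRIC — the profile is
  weakly irrotational, the input of the lineage's weak endgame `ae_eq_zero_of_symm_traceFree_of_growth` (`…IrrotationalTools`) and of the filled
  symmetric-weak stratum (`stub_symmetricWeak`).

WHAT THIS IS NOT: not a proof of the stub or the crux; the passage member ⇒ (curl-tested identity) is `ProfileEquation.weak_profile_equation` plus the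
vanishing of the Lamb term (the hypothesis), not re-derived here; nothing about Navier–Stokes. [folklore]
-/

noncomputable section

-- flat `Theorems/<Route><Decl>…` files of one crux share the namespace of the crux (tree convention)
set_option linter.dupNamespace false

open MeasureTheory Set Filter Topology Metric Function TopologicalSpace
open scoped RealInnerProductSpace NNReal ENNReal ContDiff

namespace Summit.NavierStokesRegularity.NavierStokesRegularity.Theorems.PowerGaugeEulerLiouville

open Literature.Analysis Literature.Analysis.FunctionSpaces Literature.Analysis.FluidPDE

namespace WeakCommuting

/-! ### Test-function calculus for the curl pairs `η_ψ = (∂ᵥψ) w − (∂_w ψ) v` -/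

/-- A smooth compactly supported scalar function is a test function on `ℝ³`. [folklore] -/
theorem isTestFunctionOn_top_of_contDiff {ψ : EuclideanSpace ℝ (Fin 3) → ℝ} (hψ : ContDiff ℝ ∞ ψ) (hψs : HasCompactSupport ψ) :
    IsTestFunctionOn (⊤ : Opens (EuclideanSpace ℝ (Fin 3))) ψ :=
  ⟨hψ, hψs, by simp⟩

/-- The radial derivative `h(z) = Dψ(z)[z]` of a test function is a test function. [folklore] -/
theorem isTestFunctionOn_radialDeriv {ψ : EuclideanSpace ℝ (Fin 3) → ℝ} (hψ : ContDiff ℝ ∞ ψ) (hψs : HasCompactSupport ψ) :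
    IsTestFunctionOn (⊤ : Opens (EuclideanSpace ℝ (Fin 3))) (fun z : EuclideanSpace ℝ (Fin 3) => fderiv ℝ ψ z z) := by
  refine ⟨(hψ.fderiv_right (m := ∞) le_rfl).clm_apply contDiff_id, ?_, by simp⟩
  refine (hψs.fderiv (𝕜 := ℝ)).mono fun z hz => ?_
  rw [mem_support] at hz ⊢
  contrapose! hz
  simp [hz]

/-- Second-derivative bookkeeping: `D²ψ(y)[y][v] = D(Dψ[·][·])(y)[v] − Dψ(y)[v]` (symmetry of `D²ψ`). [folklore] -/
theorem fderiv_fderiv_apply_self {ψ : EuclideanSpace ℝ (Fin 3) → ℝ} (hψ : ContDiff ℝ ∞ ψ) (y v : EuclideanSpace ℝ (Fin 3)) :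
    fderiv ℝ (fun z : EuclideanSpace ℝ (Fin 3) => fderiv ℝ ψ z v) y y =
      fderiv ℝ (fun z : EuclideanSpace ℝ (Fin 3) => fderiv ℝ ψ z z) y v - fderiv ℝ ψ y v := by
  have hd : DifferentiableAt ℝ (fderiv ℝ ψ) y :=
    ((hψ.fderiv_right (m := ∞) le_rfl).differentiable (by simp)).differentiableAt
  have h1 : fderiv ℝ (fun z : EuclideanSpace ℝ (Fin 3) => fderiv ℝ ψ z v) y y = fderiv ℝ (fderiv ℝ ψ) y y v := by
    rw [fderiv_clm_apply hd (differentiableAt_const v)]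
    simp
  have h2 : fderiv ℝ (fun z : EuclideanSpace ℝ (Fin 3) => fderiv ℝ ψ z z) y v =
      fderiv ℝ (fderiv ℝ ψ) y v y + fderiv ℝ ψ y v := by
    show fderiv ℝ (fun z : EuclideanSpace ℝ (Fin 3) => fderiv ℝ ψ z (id z)) y v = _
    rw [fderiv_clm_apply hd differentiableAt_id]
    simp [add_comm]
  have hsymm : IsSymmSndFDerivAt ℝ ψ y :=
    hψ.contDiffAt.isSymmSndFDerivAt (by rw [minSmoothness_of_isRCLikeNormedField]; norm_cast)
  rw [h1, h2, hsymm.eq v y]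
  abel

/-- **`Dη_ψ(y)[y] = η_h(y) − η_ψ(y)`**, `h = Dψ[·][·]`, for the curl pair `η_ψ = (∂ᵥψ) w − (∂_w ψ) v`. [folklore] -/
theorem fderiv_curlPair_apply_self {ψ : EuclideanSpace ℝ (Fin 3) → ℝ} (hψ : ContDiff ℝ ∞ ψ) (v w y : EuclideanSpace ℝ (Fin 3)) :
    fderiv ℝ (fun z : EuclideanSpace ℝ (Fin 3) => fderiv ℝ ψ z v • w - fderiv ℝ ψ z w • v) y y =
      ((fderiv ℝ (fun z : EuclideanSpace ℝ (Fin 3) => fderiv ℝ ψ z z) y v • w -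
          fderiv ℝ (fun z : EuclideanSpace ℝ (Fin 3) => fderiv ℝ ψ z z) y w • v) -
        (fderiv ℝ ψ y v • w - fderiv ℝ ψ y w • v)) := by
  have hdv : ∀ a : EuclideanSpace ℝ (Fin 3), Differentiable ℝ (fun z : EuclideanSpace ℝ (Fin 3) => fderiv ℝ ψ z a) := fun a =>
    ((hψ.fderiv_right (m := ∞) le_rfl).differentiable (by simp)).clm_apply (differentiable_const a)
  have hs : ∀ a b : EuclideanSpace ℝ (Fin 3), DifferentiableAt ℝ (fun z : EuclideanSpace ℝ (Fin 3) => fderiv ℝ ψ z a • b) y :=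
    fun a b => (hdv a y).smul_const b
  rw [fderiv_fun_sub (hs v w) (hs w v)]
  simp only [FunLike.coe_sub, Pi.sub_apply]
  rw [fderiv_smul_const (hdv v y), fderiv_smul_const (hdv w y)]
  simp only [ContinuousLinearMap.smulRight_apply, fderiv_fderiv_apply_self hψ]
  simp only [sub_smul]
  abel

/-! ### From the curl-tested identity to the Euler identity for the weak curls -/

variable {V : EuclideanSpace ℝ (Fin 3) → EuclideanSpace ℝ (Fin 3)}
  {G : EuclideanSpace ℝ (Fin 3) → EuclideanSpace ℝ (Fin 3) →L[ℝ] EuclideanSpace ℝ (Fin 3)}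

/-- Integrability of `⟪V, W⟫` for a locally integrable `V` and a test field `W`. [folklore] -/
theorem integrable_inner_test (hV : LocallyIntegrable V volume) {W : EuclideanSpace ℝ (Fin 3) → EuclideanSpace ℝ (Fin 3)}
    (hW : IsTestFunctionOn (⊤ : Opens (EuclideanSpace ℝ (Fin 3))) W) :
    Integrable (fun y => ⟪V y, W y⟫) volume := by
  obtain ⟨C, hC⟩ := hW.contDiff.continuous.bounded_above_of_compact_support hW.hasCompactSupport
  have hK : IsCompact (tsupport W) := hW.hasCompactSupport
  have hVK : IntegrableOn (fun y => ‖V y‖) (tsupport W) volume := (hV.integrableOn_isCompact hK).norm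
  have hm : AEStronglyMeasurable (fun y => ⟪V y, W y⟫) volume :=
    hV.aestronglyMeasurable.inner hW.contDiff.continuous.aestronglyMeasurable
  have hsupp : support (fun y => ⟪V y, W y⟫) ⊆ tsupport W := by
    intro y hy
    rw [mem_support] at hy
    by_contra h
    exact hy (by rw [image_eq_zero_of_notMem_tsupport h, inner_zero_right])
  have hOn : IntegrableOn (fun y => ⟪V y, W y⟫) (tsupport W) volume := by
    refine Integrable.mono' (hVK.const_mul C) hm.restrict (Filter.Eventually.of_forall fun y => ?_)
    rw [Real.norm_eq_abs]
    calc |⟪V y, W y⟫| ≤ ‖V y‖ * ‖W y‖ := abs_real_inner_le_norm _ _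
      _ ≤ ‖V y‖ * C := mul_le_mul_of_nonneg_left (hC _) (norm_nonneg _)
      _ = C * ‖V y‖ := mul_comm _ _
  exact (integrableOn_iff_integrable_of_support_subset hsupp).1 hOn

/-- The directional derivative `∂ₐψ` of a test function is a test function on `ℝ³`. [folklore] -/
theorem isTestFunctionOn_fderiv_apply_top {ψ : EuclideanSpace ℝ (Fin 3) → ℝ} (hψ : ContDiff ℝ ∞ ψ) (hψs : HasCompactSupport ψ)
    (a : EuclideanSpace ℝ (Fin 3)) :
    IsTestFunctionOn (⊤ : Opens (EuclideanSpace ℝ (Fin 3))) (fun z : EuclideanSpace ℝ (Fin 3) => fderiv ℝ ψ z a) :=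
  ⟨(hψ.fderiv_right (m := ∞) le_rfl).clm_apply contDiff_const, hψs.fderiv_apply (𝕜 := ℝ) a, by simp⟩

/-- A continuous linear image of a locally integrable operator field is locally integrable. [folklore] -/
theorem locallyIntegrable_clm_comp' {H : Type*} [NormedAddCommGroup H] [NormedSpace ℝ H]
    {f : EuclideanSpace ℝ (Fin 3) → EuclideanSpace ℝ (Fin 3) →L[ℝ] EuclideanSpace ℝ (Fin 3)} (hf : LocallyIntegrable f volume)
    (L : (EuclideanSpace ℝ (Fin 3) →L[ℝ] EuclideanSpace ℝ (Fin 3)) →L[ℝ] H) :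
    LocallyIntegrable (fun x => L (f x)) volume :=
  locallyIntegrable_iff.2 fun _ hK => L.integrable_comp (hf.integrableOn_isCompact hK)

/-- The scalar weak-curl component `⟪G v, w⟫` is locally integrable. [folklore] -/
theorem locallyIntegrable_inner_apply (hG : HasWeakGradient V G) (a c : EuclideanSpace ℝ (Fin 3)) :
    LocallyIntegrable (fun y => ⟪G y a, c⟫) volume := by
  have hGli : LocallyIntegrable G volume := locallyIntegrableOn_univ.1 (by
    simpa only [Opens.coe_top] using hG.locallyIntegrableOn_deriv)
  have hk := locallyIntegrable_clm_comp' hGli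
    ((innerSL ℝ c).comp (ContinuousLinearMap.apply ℝ (EuclideanSpace ℝ (Fin 3)) a))
  have hfun : (fun y => ⟪G y a, c⟫) =
      fun y => ((innerSL ℝ c).comp (ContinuousLinearMap.apply ℝ (EuclideanSpace ℝ (Fin 3)) a)) (G y) := by
    funext y
    simp [real_inner_comm]
  rw [hfun]
  exact hk

/-- The weak-curl pairing as a weak-gradient pairing: for a test function `g`,
`∫ ⟪V, (∂ᵥ g) w − (∂_w g) v⟫ = −∫ g (⟪G v, w⟫ − ⟪G w, v⟫)`. [folklore] -/
theorem integral_inner_curlPair_eq (hG : HasWeakGradient V G) {g : EuclideanSpace ℝ (Fin 3) → ℝ} (hg : ContDiff ℝ ∞ g)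
    (hgs : HasCompactSupport g) (v w : EuclideanSpace ℝ (Fin 3)) :
    ∫ y, ⟪V y, fderiv ℝ g y v • w - fderiv ℝ g y w • v⟫ = -∫ y, g y * (⟪G y v, w⟫ - ⟪G y w, v⟫) := by
  have hgT : IsTestFunctionOn (⊤ : Opens (EuclideanSpace ℝ (Fin 3))) g := isTestFunctionOn_top_of_contDiff hg hgs
  have hVli : LocallyIntegrable V volume := locallyIntegrableOn_univ.1 (by
    simpa only [Opens.coe_top] using hG.locallyIntegrableOn)
  -- the two single pairings
  have e1 : ∫ y, ⟪V y, fderiv ℝ g y v • w⟫ = -∫ y, g y * ⟪G y v, w⟫ := by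
    have h1 := hG.integral_inner_fderiv_apply_test (isTestFunctionOn_smul_const hgT w) v
    simp_rw [fderiv_smul_const_apply' hgT] at h1
    rw [h1]
    congr 1
    exact integral_congr_ae (Filter.Eventually.of_forall fun x => by simp only [real_inner_smul_right])
  have e2 : ∫ y, ⟪V y, fderiv ℝ g y w • v⟫ = -∫ y, g y * ⟪G y w, v⟫ := by
    have h1 := hG.integral_inner_fderiv_apply_test (isTestFunctionOn_smul_const hgT v) w
    simp_rw [fderiv_smul_const_apply' hgT] at h1
    rw [h1]
    congr 1
    exact integral_congr_ae (Filter.Eventually.of_forall fun x => by simp only [real_inner_smul_right])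
  -- integrability of the pieces
  have hi1 : Integrable (fun y => ⟪V y, fderiv ℝ g y v • w⟫) volume :=
    integrable_inner_test hVli (isTestFunctionOn_smul_const (isTestFunctionOn_fderiv_apply_top hg hgs v) w)
  have hi2 : Integrable (fun y => ⟪V y, fderiv ℝ g y w • v⟫) volume :=
    integrable_inner_test hVli (isTestFunctionOn_smul_const (isTestFunctionOn_fderiv_apply_top hg hgs w) v)
  have hj : ∀ a c : EuclideanSpace ℝ (Fin 3), Integrable (fun y => g y * ⟪G y a, c⟫) volume := fun a c => by
    simpa [smul_eq_mul] using
      (locallyIntegrable_inner_apply hG a c).integrable_smul_left_of_hasCompactSupport hg.continuous hgs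
  calc ∫ y, ⟪V y, fderiv ℝ g y v • w - fderiv ℝ g y w • v⟫
      = ∫ y, (⟪V y, fderiv ℝ g y v • w⟫ - ⟪V y, fderiv ℝ g y w • v⟫) :=
        integral_congr_ae (Filter.Eventually.of_forall fun y => inner_sub_right _ _ _)
    _ = (∫ y, ⟪V y, fderiv ℝ g y v • w⟫) - ∫ y, ⟪V y, fderiv ℝ g y w • v⟫ := integral_sub hi1 hi2
    _ = -(∫ y, g y * ⟪G y v, w⟫) - -(∫ y, g y * ⟪G y w, v⟫) := by rw [e1, e2]
    _ = -∫ y, g y * (⟪G y v, w⟫ - ⟪G y w, v⟫) := by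
        have : ∫ y, g y * (⟪G y v, w⟫ - ⟪G y w, v⟫) = (∫ y, g y * ⟪G y v, w⟫) - ∫ y, g y * ⟪G y w, v⟫ := by
          rw [← integral_sub (hj v w) (hj w v)]
          exact integral_congr_ae (Filter.Eventually.of_forall fun y => mul_sub _ _ _)
        rw [this]
        ring

/-- **THE EULER IDENTITY FOR THE WEAK CURLS.**  If `V` has the weak gradient `G` and satisfies the curl-tested weak profile identity without
Lamb term at rate `γ ≠ 0`, then every scalar weak curl `ω_{v,w} = ⟪G v, w⟫ − ⟪G w, v⟫` is a homogeneous distribution of degree `κ = −1/γ`: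
`∫ Dφ(y)[y] ω = −(3 + κ) ∫ φ ω` for all test functions `φ`. [folklore] -/
theorem weakCurl_euler_identity (hG : HasWeakGradient V G) {γ : ℝ} (hγ : γ ≠ 0)
    (hCT : ∀ ψ : EuclideanSpace ℝ (Fin 3) → ℝ, ContDiff ℝ ∞ ψ → HasCompactSupport ψ → ∀ v w : EuclideanSpace ℝ (Fin 3),
      γ * (∫ y, ⟪V y, fderiv ℝ (fun z : EuclideanSpace ℝ (Fin 3) => fderiv ℝ ψ z v • w - fderiv ℝ ψ z w • v) y y⟫) +
        (4 * γ - 1) * (∫ y, ⟪V y, fderiv ℝ ψ y v • w - fderiv ℝ ψ y w • v⟫) = 0)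
    (v w : EuclideanSpace ℝ (Fin 3)) :
    ∀ φ : EuclideanSpace ℝ (Fin 3) → ℝ, ContDiff ℝ ∞ φ → HasCompactSupport φ →
      ∫ y, (fderiv ℝ φ y y) • (⟪G y v, w⟫ - ⟪G y w, v⟫) =
        -((3 + -(1 / γ)) • ∫ y, φ y • (⟪G y v, w⟫ - ⟪G y w, v⟫)) := by
  intro φ hφ hφs
  have hVli : LocallyIntegrable V volume := locallyIntegrableOn_univ.1 (by
    simpa only [Opens.coe_top] using hG.locallyIntegrableOn)
  -- the radial derivative `h = Dφ[·][·]` is a test function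
  have hhT := isTestFunctionOn_radialDeriv hφ hφs
  -- `∫⟪V, Dη_φ[y]⟫ = T(h) − T(φ)`
  have hsplit : ∫ y, ⟪V y, fderiv ℝ (fun z : EuclideanSpace ℝ (Fin 3) => fderiv ℝ φ z v • w - fderiv ℝ φ z w • v) y y⟫ =
      (∫ y, ⟪V y, fderiv ℝ (fun z : EuclideanSpace ℝ (Fin 3) => fderiv ℝ φ z z) y v • w -
          fderiv ℝ (fun z : EuclideanSpace ℝ (Fin 3) => fderiv ℝ φ z z) y w • v⟫) -
        ∫ y, ⟪V y, fderiv ℝ φ y v • w - fderiv ℝ φ y w • v⟫ := by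
    rw [← integral_sub (integrable_inner_test hVli (isTestFunctionOn_fderiv_smul_sub hhT.contDiff hhT.hasCompactSupport v w))
      (integrable_inner_test hVli (isTestFunctionOn_fderiv_smul_sub hφ hφs v w))]
    refine integral_congr_ae (Filter.Eventually.of_forall fun y => ?_)
    beta_reduce
    rw [fderiv_curlPair_apply_self hφ v w y, inner_sub_right]
  -- the curl-tested identity, with the first integral split (the two sides agree definitionally)
  have hmain : γ * ((∫ y, ⟪V y, fderiv ℝ (fun z : EuclideanSpace ℝ (Fin 3) => fderiv ℝ φ z z) y v • w -
          fderiv ℝ (fun z : EuclideanSpace ℝ (Fin 3) => fderiv ℝ φ z z) y w • v⟫) -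
        ∫ y, ⟪V y, fderiv ℝ φ y v • w - fderiv ℝ φ y w • v⟫) +
      (4 * γ - 1) * (∫ y, ⟪V y, fderiv ℝ φ y v • w - fderiv ℝ φ y w • v⟫) = 0 := by
    rw [← hsplit]
    exact hCT φ hφ hφs v w
  rw [integral_inner_curlPair_eq hG hhT.contDiff hhT.hasCompactSupport v w,
    integral_inner_curlPair_eq hG hφ hφs v w] at hmain
  -- `hmain : γ (−∫ h ω + ∫ φ ω) + (4γ−1)(−∫ φ ω) = 0`
  simp only [smul_eq_mul]
  have hkey : γ * ∫ y, fderiv ℝ φ y y * (⟪G y v, w⟫ - ⟪G y w, v⟫) = (1 - 3 * γ) * ∫ y, φ y * (⟪G y v, w⟫ - ⟪G y w, v⟫) := by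
    linarith
  have : ∫ y, fderiv ℝ φ y y * (⟪G y v, w⟫ - ⟪G y w, v⟫) = ((1 - 3 * γ) / γ) * ∫ y, φ y * (⟪G y v, w⟫ - ⟪G y w, v⟫) := by
    rw [div_mul_eq_mul_div, eq_div_iff hγ, mul_comm, hkey]
  rw [this]
  have hc : (1 - 3 * γ) / γ = -(3 + -(1 / γ)) := by field_simp; ring
  rw [hc, neg_mul]

/-- **WEAKLY COMMUTING WEAK PROFILES ARE WEAKLY IRROTATIONAL.**  If moreover `0 < γ < 2/3` (every class rate `γ = 1/(2+ρ)`, `ρ > 0`) and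
`‖G‖²` is integrable on the closed unit ball (`G ∈ L²_loc` near the origin), then every weak curl vanishes: `⟪G v, w⟫ = ⟪G w, v⟫` a.e., for
all `v, w` (`WeakHomogeneity.ae_eq_zero_of_sq_integrableOn`, degree `κ = −1/γ < −3/2`). [folklore] -/
theorem weakCurl_ae_eq_zero (hG : HasWeakGradient V G) {γ : ℝ} (hγ : 0 < γ) (hγ1 : γ < 2 / 3)
    (hCT : ∀ ψ : EuclideanSpace ℝ (Fin 3) → ℝ, ContDiff ℝ ∞ ψ → HasCompactSupport ψ → ∀ v w : EuclideanSpace ℝ (Fin 3),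
      γ * (∫ y, ⟪V y, fderiv ℝ (fun z : EuclideanSpace ℝ (Fin 3) => fderiv ℝ ψ z v • w - fderiv ℝ ψ z w • v) y y⟫) +
        (4 * γ - 1) * (∫ y, ⟪V y, fderiv ℝ ψ y v • w - fderiv ℝ ψ y w • v⟫) = 0)
    (hG2 : IntegrableOn (fun y => ‖G y‖ ^ 2) (closedBall (0 : EuclideanSpace ℝ (Fin 3)) 1) volume)
    (v w : EuclideanSpace ℝ (Fin 3)) :
    (fun y => ⟪G y v, w⟫ - ⟪G y w, v⟫) =ᵐ[volume] 0 := by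
  have hω : LocallyIntegrable (fun y => ⟪G y v, w⟫ - ⟪G y w, v⟫) volume :=
    (locallyIntegrable_inner_apply hG v w).sub (locallyIntegrable_inner_apply hG w v)
  have hκ : -(1 / γ) < -(3 / 2 : ℝ) := by
    rw [neg_lt_neg_iff, lt_div_iff₀ hγ]
    linarith
  have hhom := weakCurl_euler_identity hG hγ.ne' hCT v w
  -- square-integrability of the weak curl on the unit ball
  have hω2 : IntegrableOn (fun y => ‖⟪G y v, w⟫ - ⟪G y w, v⟫‖ ^ 2) (closedBall (0 : EuclideanSpace ℝ (Fin 3)) 1) volume := by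
    have hm : AEStronglyMeasurable (fun y => ‖⟪G y v, w⟫ - ⟪G y w, v⟫‖ ^ 2)
        (volume.restrict (closedBall (0 : EuclideanSpace ℝ (Fin 3)) 1)) :=
      (hω.aestronglyMeasurable.norm.pow 2).restrict
    refine Integrable.mono' (hG2.const_mul ((2 * ‖v‖ * ‖w‖) ^ 2)) hm (Filter.Eventually.of_forall fun y => ?_)
    rw [Real.norm_eq_abs, abs_of_nonneg (sq_nonneg _), Real.norm_eq_abs]
    have hb : |⟪G y v, w⟫ - ⟪G y w, v⟫| ≤ 2 * ‖v‖ * ‖w‖ * ‖G y‖ := by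
      have h1 : |⟪G y v, w⟫| ≤ ‖G y‖ * ‖v‖ * ‖w‖ :=
        (abs_real_inner_le_norm _ _).trans (mul_le_mul_of_nonneg_right (ContinuousLinearMap.le_opNorm _ _) (norm_nonneg _))
      have h2 : |⟪G y w, v⟫| ≤ ‖G y‖ * ‖w‖ * ‖v‖ :=
        (abs_real_inner_le_norm _ _).trans (mul_le_mul_of_nonneg_right (ContinuousLinearMap.le_opNorm _ _) (norm_nonneg _))
      calc |⟪G y v, w⟫ - ⟪G y w, v⟫| ≤ |⟪G y v, w⟫| + |⟪G y w, v⟫| := abs_sub _ _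
        _ ≤ ‖G y‖ * ‖v‖ * ‖w‖ + ‖G y‖ * ‖w‖ * ‖v‖ := add_le_add h1 h2
        _ = 2 * ‖v‖ * ‖w‖ * ‖G y‖ := by ring
    have h0 : 0 ≤ 2 * ‖v‖ * ‖w‖ * ‖G y‖ := by positivity
    calc |⟪G y v, w⟫ - ⟪G y w, v⟫| ^ 2 ≤ (2 * ‖v‖ * ‖w‖ * ‖G y‖) ^ 2 :=
          pow_le_pow_left₀ (abs_nonneg _) hb 2
      _ = (2 * ‖v‖ * ‖w‖) ^ 2 * ‖G y‖ ^ 2 := by ring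
  exact WeakHomogeneity.ae_eq_zero_of_sq_integrableOn (F := ℝ) hω hκ hhom hω2

/-! ### The weak endgame: symmetric weak gradient, hence the profile vanishes under the `A`-gauge growth -/

/-- **The weak gradient is a.e. symmetric** (simultaneously for all directions): from `weakCurl_ae_eq_zero` on the standard basis and
bilinearity. [folklore] -/
theorem ae_symm_weakGradient (hG : HasWeakGradient V G) {γ : ℝ} (hγ : 0 < γ) (hγ1 : γ < 2 / 3)
    (hCT : ∀ ψ : EuclideanSpace ℝ (Fin 3) → ℝ, ContDiff ℝ ∞ ψ → HasCompactSupport ψ → ∀ v w : EuclideanSpace ℝ (Fin 3),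
      γ * (∫ y, ⟪V y, fderiv ℝ (fun z : EuclideanSpace ℝ (Fin 3) => fderiv ℝ ψ z v • w - fderiv ℝ ψ z w • v) y y⟫) +
        (4 * γ - 1) * (∫ y, ⟪V y, fderiv ℝ ψ y v • w - fderiv ℝ ψ y w • v⟫) = 0)
    (hG2 : IntegrableOn (fun y => ‖G y‖ ^ 2) (closedBall (0 : EuclideanSpace ℝ (Fin 3)) 1) volume) :
    ∀ᵐ x ∂(volume : Measure (EuclideanSpace ℝ (Fin 3))), ∀ v w : EuclideanSpace ℝ (Fin 3), ⟪G x v, w⟫ = ⟪G x w, v⟫ := by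
  set b := EuclideanSpace.basisFun (Fin 3) ℝ with hb
  have hij : ∀ i j : Fin 3, ∀ᵐ x ∂(volume : Measure (EuclideanSpace ℝ (Fin 3))), ⟪G x (b i), b j⟫ = ⟪G x (b j), b i⟫ := by
    intro i j
    filter_upwards [weakCurl_ae_eq_zero hG hγ hγ1 hCT hG2 (b i) (b j)] with x hx
    exact sub_eq_zero.1 hx
  have hall : ∀ᵐ x ∂(volume : Measure (EuclideanSpace ℝ (Fin 3))), ∀ i j : Fin 3, ⟪G x (b i), b j⟫ = ⟪G x (b j), b i⟫ := by
    rw [ae_all_iff]; intro i; rw [ae_all_iff]; intro j; exact hij i j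
  filter_upwards [hall] with x hx
  intro v w
  conv_lhs => rw [← b.sum_repr' v, ← b.sum_repr' w]
  conv_rhs => rw [← b.sum_repr' v, ← b.sum_repr' w]
  simp only [map_sum, map_smul, sum_inner, inner_sum, real_inner_smul_left, real_inner_smul_right]
  rw [Finset.sum_comm]
  refine Finset.sum_congr rfl fun i _ => Finset.sum_congr rfl fun j _ => ?_
  rw [hx j i]
  ring

/-- `tr G = 0` a.e. in coordinates, for the weak gradient of a weakly divergence-free field. [folklore] -/
theorem ae_trace_coord_eq_zero (hG : HasWeakGradient V G) (hdiv : IsWeaklyDivFree V) :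
    ∀ᵐ x ∂(volume : Measure (EuclideanSpace ℝ (Fin 3))), ∑ j, G x (EuclideanSpace.single j (1 : ℝ)) j = 0 := by
  filter_upwards [IsWeaklyDivFree.trace_weakGradient_ae_eq_zero hdiv hG] with x hx
  rw [LinearMap.trace_eq_sum_inner _ (EuclideanSpace.basisFun (Fin 3) ℝ)] at hx
  simpa [EuclideanSpace.inner_single_left] using hx

/-- **WEAKLY COMMUTING WEAK PROFILES ARE TRIVIAL UNDER THE `A`-GAUGE GROWTH.**  Profile level, weak class: `V` with whole-space weak gradient
`G`, `‖G‖²` integrable on the closed unit ball, `V` weakly divergence free, the curl-tested weak profile identity without Lamb term at a rate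
`0 < γ < 2/3`, and the sub-volume quadratic growth `∫_{B(0,r)} ‖V‖² ≤ K r^m` (`m < 3`, `r > r₀`; for class members the `A`-gauge gives
`m = 1 − 2ρ`): then `V = 0` a.e. — symmetric and trace-free weak gradient make every component weakly harmonic, and the growth bound kills it
(`ae_eq_zero_of_symm_traceFree_of_growth`, `…IrrotationalTools`). [folklore] -/
theorem ae_eq_zero_of_curlTested (hG : HasWeakGradient V G) (hdiv : IsWeaklyDivFree V) {γ : ℝ} (hγ : 0 < γ) (hγ1 : γ < 2 / 3)
    (hCT : ∀ ψ : EuclideanSpace ℝ (Fin 3) → ℝ, ContDiff ℝ ∞ ψ → HasCompactSupport ψ → ∀ v w : EuclideanSpace ℝ (Fin 3),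
      γ * (∫ y, ⟪V y, fderiv ℝ (fun z : EuclideanSpace ℝ (Fin 3) => fderiv ℝ ψ z v • w - fderiv ℝ ψ z w • v) y y⟫) +
        (4 * γ - 1) * (∫ y, ⟪V y, fderiv ℝ ψ y v • w - fderiv ℝ ψ y w • v⟫) = 0)
    (hG2 : IntegrableOn (fun y => ‖G y‖ ^ 2) (closedBall (0 : EuclideanSpace ℝ (Fin 3)) 1) volume)
    {K m r₀ : ℝ} (hm : m < 3)
    (hgrowth : ∀ r : ℝ, r₀ < r → 0 < r →
      ∫⁻ x in ball (0 : EuclideanSpace ℝ (Fin 3)) r, ‖V x‖ₑ ^ 2 ≤ ENNReal.ofReal (K * r ^ m)) :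
    V =ᵐ[volume] 0 :=
  ae_eq_zero_of_symm_traceFree_of_growth hG (ae_symm_weakGradient hG hγ hγ1 hCT hG2) (ae_trace_coord_eq_zero hG hdiv) hm hgrowth

end WeakCommuting

end Summit.NavierStokesRegularity.NavierStokesRegularity.Theorems.PowerGaugeEulerLiouville

end
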